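import Mathlib.Combinatorics.SimpleGraph.Metric
import Mathlib.Combinatorics.SimpleGraph.Walk.Operations
import Mathlib.Data.Int.Interval
import Mathlib.Algebra.Order.Group.Abs
import Mathlib.Data.Fintype.BigOperators
import Mathlib.Algebra.BigOperators.Ring.Finset
import Mathlib.Tactic.Linarith
import Mathlib.Tactic.Ring
import Mathlib.Tactic.Positivity
import Mathlib.Tactic.Push
import HarnessLib

/-!
# Large connected sets contract under coarse-graining (the `η`-inequality of Brydges–Slade)

Fine blocks are the points of `ℤ^d` (`Fin d → ℤ`), two blocks *touch* when their `ℓ^∞`-distance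
is `≤ 1`, and the coarse-graining map of a blocking with side lengths `L k ≥ 1` is
`π(x)_k = ⌊x_k / L_k⌋` (`coarse L x`). For a finite set `X` of fine blocks, `|π(X)|` — the number
of coarse blocks met by `X`, i.e. the size of the *closure* `X̄` of Brydges–Slade — is at most
`|X|`. The geometric input of the reblocking step of a multi-scale (renormalisation-group)
expansion is that for CONNECTED sets which are not *small* this improves by a definite factor:

  **Theorem** (`card_coarse_image_le_of_connected`). If every `L_k ≥ 2^{d+1} + 1`, `X` is
  connected (for the touching relation) and `|X| ≥ 2^d + 1`, then
  `(K_d + 2)·|π(X)| ≤ (K_d + 1)·|X|`, `K_d = 2^d(3^d − 1)`, i.e. `|X| ≥ η_d |π(X)|` with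
  `η_d = 1 + 1/(K_d+1) > 1`.

This is (with a different constant) inequality (e:etaineq)/Lemma C.3 of Brydges–Slade,
*A renormalisation group method. V*, for which we give a new, self-contained proof by charging:
coarse blocks containing exactly one fine block of `X` ("singly occupied") carry fine blocks on
which `π` is injective; a touching-connected set on which `π` is injective has at most `2^d`
elements (`card_le_two_pow_of_injOn_of_preconnected`: the ball of graph-radius `2^d` around any of
its points has `≥ 2^d + 1` elements but `ℓ^∞`-diameter `≤ 2^{d+1} ≤ L − 1`, so it meets at most
`2^d` coarse blocks — `card_image_coarse_le_two_pow_of_diam`); every touching-component of the singly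
occupied fine blocks touches a fine block of `X` in a multiply occupied coarse block (connectedness
of `X`, `X` not small), and at most `3^d − 1` components can touch the same coarse block. Hence
`#singly ≤ 2^d(3^d−1)·#multiply` while `|X| ≥ #singly + 2·#multiply`.

Also: `card_image_coarse_le` (`|π(X)| ≤ |X|`), `coarse_sub_coarse_le_one` (touching fine blocks lie in
touching coarse blocks), `card_blockTouchSet_eq` (`3^d` blocks touch a given block).

## References

* D. C. Brydges, G. Slade, *A renormalisation group method. V. A single renormalisation group
  step*, J. Stat. Phys. 159 (2015) 589–667, Lemma C.3 / (1.23) (`|X|_j ≥ η|X̄|_{j+1}` for large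
  connected `X`, `L ≥ 2^d + 1`). [BrydgesSlade2015RGV]
* R. Bauerschmidt, D. C. Brydges, G. Slade, *Introduction to a Renormalisation Group Method*,
  LNM 2242 (2019), §1 of Part II (blocks, polymers, small sets). [BauerschmidtBrydgesSlade2019RG]
-/

namespace Literature.Probability.LatticeModels

open Finset SimpleGraph

variable {d : ℕ}

/-! ### Fine blocks, touching, coarse-graining -/

/-- Two fine blocks `x, y ∈ ℤ^d` **touch** if `|x_k − y_k| ≤ 1` for every coordinate (closed unit
`ℓ^∞`-ball; a reflexive, symmetric relation). [cite: BrydgesSlade2015RGV, §1.1 (c)] -/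
def BlockTouch (x y : Fin d → ℤ) : Prop := ∀ k, |x k - y k| ≤ 1

/-- Touching is decidable. [folklore] -/
instance (x y : Fin d → ℤ) : Decidable (BlockTouch x y) := inferInstanceAs (Decidable (∀ k, |x k - y k| ≤ 1))

/-- Touching is reflexive. [folklore] -/
theorem BlockTouch.refl (x : Fin d → ℤ) : BlockTouch x x := fun k => by simp

/-- Touching is symmetric. [folklore] -/
theorem BlockTouch.symm {x y : Fin d → ℤ} (h : BlockTouch x y) : BlockTouch y x := fun k => by
  rw [abs_sub_comm]; exact h k

/-- **The coarse-graining map** of the blocking with side lengths `L k`: `π(x)_k = ⌊x_k/L_k⌋`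
(integer floor division). [cite: BrydgesSlade2015RGV, Def. 1.2 (closure)] -/
def coarse (L : Fin d → ℕ) (x : Fin d → ℤ) : Fin d → ℤ := fun k => x k / (L k : ℤ)

/-- **Touching fine blocks lie in touching coarse blocks**: `|π(x)_k − π(y)_k| ≤ 1` when
`|x_k − y_k| ≤ 1` and `L_k ≥ 1`. [folklore] -/
theorem coarse_sub_coarse_le_one {L : Fin d → ℕ} (hL : ∀ k, 1 ≤ L k) {x y : Fin d → ℤ} (h : BlockTouch x y) :
    BlockTouch (coarse L x) (coarse L y) := by
  intro k
  have hLk : (0 : ℤ) < L k := by exact_mod_cast hL k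
  have h1 := h k
  rw [abs_le] at h1 ⊢
  simp only [coarse]
  constructor
  · -- `y/L - 1 ≤ x/L` from `y - 1 ≤ x`... via `y ≤ x + 1 ≤ x + L`
    have : y k / (L k : ℤ) ≤ x k / (L k : ℤ) + 1 := by
      have h2 : y k ≤ x k + 1 * (L k : ℤ) := by linarith
      calc y k / (L k : ℤ) ≤ (x k + 1 * (L k : ℤ)) / (L k : ℤ) := Int.ediv_le_ediv hLk h2
        _ = x k / (L k : ℤ) + 1 := by rw [Int.add_mul_ediv_right _ _ hLk.ne']
    linarith
  · have : x k / (L k : ℤ) ≤ y k / (L k : ℤ) + 1 := by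
      have h2 : x k ≤ y k + 1 * (L k : ℤ) := by linarith
      calc x k / (L k : ℤ) ≤ (y k + 1 * (L k : ℤ)) / (L k : ℤ) := Int.ediv_le_ediv hLk h2
        _ = y k / (L k : ℤ) + 1 := by rw [Int.add_mul_ediv_right _ _ hLk.ne']
    linarith

/-- `|π(X)| ≤ |X|` (the closure of `m` blocks has at most `m` coarse blocks; `η = 1`).
[cite: BrydgesSlade2015RGV, Lemma C.3] -/
theorem card_image_coarse_le (L : Fin d → ℕ) (X : Finset (Fin d → ℤ)) : (X.image (coarse L)).card ≤ X.card :=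
  card_image_le

/-! ### Sets of small diameter meet at most `2^d` coarse blocks -/

/-- Floor division pins a window of width `< L` to two consecutive quotients: if
`0 ≤ t − s ≤ L − 1` then `⌊t/L⌋ ∈ {⌊s/L⌋, ⌊s/L⌋ + 1}`. [folklore] -/
theorem ediv_eq_or_eq_add_one_of_sub_lt {L : ℤ} (hL : 0 < L) {s t : ℤ} (h0 : s ≤ t) (h1 : t - s ≤ L - 1) :
    t / L = s / L ∨ t / L = s / L + 1 := by
  have hlo : s / L ≤ t / L := Int.ediv_le_ediv hL h0
  have hhi : t / L ≤ s / L + 1 := by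
    have h2 : t ≤ s + 1 * L := by linarith
    calc t / L ≤ (s + 1 * L) / L := Int.ediv_le_ediv hL h2
      _ = s / L + 1 := by rw [Int.add_mul_ediv_right _ _ hL.ne']
  omega

/-- **A set of `ℓ^∞`-radius `r` around `a` with `2r ≤ L_k − 1` meets at most `2^d` coarse blocks.**
[cite: BrydgesSlade2015RGV, §1.1 (small sets)] -/
theorem card_image_coarse_le_two_pow_of_diam {L : Fin d → ℕ} {r : ℕ} (hL : ∀ k, 2 * r + 1 ≤ L k)
    (a : Fin d → ℤ) (T : Finset (Fin d → ℤ)) (hT : ∀ x ∈ T, ∀ k, |x k - a k| ≤ r) :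
    (T.image (coarse L)).card ≤ 2 ^ d := by
  classical
  -- every `π(x)`, `x ∈ T`, is `c + ε` with `ε ∈ {0,1}^d`, `c_k = ⌊(a_k - r)/L_k⌋`
  set c : Fin d → ℤ := fun k => (a k - r) / (L k : ℤ) with hc
  set F : (Fin d → Bool) → (Fin d → ℤ) := fun ε k => c k + (if ε k then 1 else 0) with hF
  have hsub : T.image (coarse L) ⊆ (Finset.univ : Finset (Fin d → Bool)).image F := by
    intro u hu
    obtain ⟨x, hx, rfl⟩ := mem_image.1 hu
    have hk : ∀ k, coarse L x k = c k ∨ coarse L x k = c k + 1 := by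
      intro k
      have hLk : (0 : ℤ) < L k := by have := hL k; omega
      have h := hT x hx k
      rw [abs_le] at h
      refine ediv_eq_or_eq_add_one_of_sub_lt hLk (by linarith) ?_
      have := hL k
      linarith
    refine mem_image.2 ⟨fun k => decide (coarse L x k = c k + 1), mem_univ _, ?_⟩
    funext k
    rcases hk k with h | h
    · simp [hF, h]
    · simp [hF, h]
  calc (T.image (coarse L)).card ≤ ((Finset.univ : Finset (Fin d → Bool)).image F).card := card_le_card hsub
    _ ≤ (Finset.univ : Finset (Fin d → Bool)).card := card_image_le
    _ = 2 ^ d := by simp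

/-! ### The touching graph of a finite set and its metric -/

/-- The **touching graph** of a finite set `X` of fine blocks, as a simple graph on all of `ℤ^d`
(vertices outside `X` are isolated): `x ~ y` iff `x ≠ y`, `x, y ∈ X` and `x, y` touch.
[cite: BrydgesSlade2015RGV, §1.1 (c)] -/
def blockTouchGraph (X : Finset (Fin d → ℤ)) : SimpleGraph (Fin d → ℤ) where
  Adj x y := x ≠ y ∧ x ∈ X ∧ y ∈ X ∧ BlockTouch x y
  symm := ⟨fun _ _ h => ⟨h.1.symm, h.2.2.1, h.2.1, h.2.2.2.symm⟩⟩
  loopless := ⟨fun _ h => h.1 rfl⟩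

/-- Adjacency of the touching graph is decidable. [folklore] -/
instance (X : Finset (Fin d → ℤ)) : DecidableRel (blockTouchGraph X).Adj :=
  fun x y => inferInstanceAs (Decidable (x ≠ y ∧ x ∈ X ∧ y ∈ X ∧ BlockTouch x y))

/-- A set of fine blocks is **connected** if it is non-empty and any two of its blocks are joined
by a chain of touching blocks of the set. [cite: BrydgesSlade2015RGV, §1.1 (c)] -/
def IsBlockConnected (X : Finset (Fin d → ℤ)) : Prop :=
  X.Nonempty ∧ ∀ x ∈ X, ∀ y ∈ X, (blockTouchGraph X).Reachable x y

/-- Along a walk of the touching graph every coordinate moves by at most the length. [folklore] -/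
theorem abs_sub_le_length {X : Finset (Fin d → ℤ)} {x y : Fin d → ℤ} (p : (blockTouchGraph X).Walk x y) (k : Fin d) :
    |x k - y k| ≤ p.length := by
  induction p with
  | nil => simp
  | cons h q ih =>
      rename_i u v w
      have h1 : |u k - v k| ≤ 1 := h.2.2.2 k
      have he : u k - w k = (u k - v k) + (v k - w k) := by ring
      calc |u k - w k| = |(u k - v k) + (v k - w k)| := by rw [he]
        _ ≤ |u k - v k| + |v k - w k| := abs_add_le _ _
        _ ≤ 1 + q.length := add_le_add h1 ih
        _ = (SimpleGraph.Walk.cons h q).length := by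
            rw [SimpleGraph.Walk.length_cons]; push_cast; ring

/-- Reachable blocks are within `ℓ^∞`-distance the graph distance. [folklore] -/
theorem abs_sub_le_dist {X : Finset (Fin d → ℤ)} {x y : Fin d → ℤ} (h : (blockTouchGraph X).Reachable x y) (k : Fin d) :
    |x k - y k| ≤ (blockTouchGraph X).dist x y := by
  obtain ⟨p, hp⟩ := h.exists_walk_length_eq_dist
  rw [← hp]
  exact abs_sub_le_length p k

/-- A walk of the touching graph of `X` that starts in `X`... every vertex of a non-trivial walk lies
in `X`; in particular reachable distinct points are in `X`. [folklore] -/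
theorem mem_of_reachable {X : Finset (Fin d → ℤ)} {x y : Fin d → ℤ} (h : (blockTouchGraph X).Reachable x y)
    (hxy : x ≠ y) : y ∈ X := by
  obtain ⟨p⟩ := h
  induction p with
  | nil => exact absurd rfl hxy
  | cons h q ih =>
      rename_i u v w
      by_cases hvw : v = w
      · subst hvw; exact h.2.2.1
      · exact ih hvw

/-- **Growth of balls**: in a connected set `Q`, the ball of graph-radius `r` around `a ∈ Q` has at
least `min(r+1, |Q|)` elements. [folklore] -/
theorem min_le_card_ball {Q : Finset (Fin d → ℤ)} (hQ : ∀ x ∈ Q, ∀ y ∈ Q, (blockTouchGraph Q).Reachable x y)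
    {a : Fin d → ℤ} (ha : a ∈ Q) (r : ℕ) :
    min (r + 1) Q.card ≤ (Q.filter fun x => (blockTouchGraph Q).dist a x ≤ r).card := by
  classical
  induction r with
  | zero =>
      have h1 : 1 ≤ (Q.filter fun x => (blockTouchGraph Q).dist a x ≤ 0).card :=
        card_pos.2 ⟨a, mem_filter.2 ⟨ha, by simp⟩⟩
      simp only [zero_add]
      exact (min_le_left _ _).trans h1
  | succ r ih =>
      set B : ℕ → Finset (Fin d → ℤ) := fun s => Q.filter fun x => (blockTouchGraph Q).dist a x ≤ s with hB
      by_cases hfull : B r = Q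
      · -- the ball already exhausts `Q`
        have hmono : B r ⊆ B (r + 1) := fun x hx => by
          simp only [hB, mem_filter] at hx ⊢; exact ⟨hx.1, hx.2.trans (Nat.le_succ r)⟩
        have : Q.card ≤ (B (r + 1)).card := by
          calc Q.card = (B r).card := by rw [hfull]
            _ ≤ (B (r + 1)).card := card_le_card hmono
        exact (min_le_right _ _).trans this
      · -- there is a point at distance exactly `r + 1`
        have hsub : B r ⊆ Q := filter_subset _ _
        have hss : B r ⊂ Q := lt_of_le_of_ne hsub hfull
        obtain ⟨y, hyQ, hyB⟩ := exists_of_ssubset hss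
        -- among the points outside the ball choose one of minimal distance
        have hne : (Q.filter fun x => ¬ (blockTouchGraph Q).dist a x ≤ r).Nonempty :=
          ⟨y, mem_filter.2 ⟨hyQ, fun h => hyB (mem_filter.2 ⟨hyQ, h⟩)⟩⟩
        obtain ⟨z, hzmem, hzmin⟩ := exists_min_image _ (fun x => (blockTouchGraph Q).dist a x) hne
        rw [mem_filter] at hzmem
        obtain ⟨hzQ, hzr⟩ := hzmem
        push Not at hzr
        -- a shortest walk from `a` to `z`, and its last step
        obtain ⟨p, hp⟩ := (hQ a ha z hzQ).exists_walk_length_eq_dist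
        have hlen : 1 ≤ p.length := by rw [hp]; omega
        -- decompose the reversed walk
        have key : (blockTouchGraph Q).dist a z ≤ r + 1 := by
          cases hp' : p.reverse with
          | nil =>
              have h0 : p.length = 0 := by
                have := congrArg SimpleGraph.Walk.length hp'
                simpa using this
              omega
          | cons h q =>
              rename_i u
              -- `u` is the penultimate vertex: `dist a u ≤ p.length - 1`
              have hq : q.reverse.length = p.length - 1 := by
                have := congrArg SimpleGraph.Walk.length hp'
                simp only [SimpleGraph.Walk.length_reverse, SimpleGraph.Walk.length_cons] at this
                rw [SimpleGraph.Walk.length_reverse]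
                omega
              have hdu : (blockTouchGraph Q).dist a u ≤ p.length - 1 := by
                rw [← hq]; exact SimpleGraph.dist_le q.reverse
              have huQ : u ∈ Q := h.2.2.1
              -- by minimality of `z`, `u` lies in the ball
              have hur : (blockTouchGraph Q).dist a u ≤ r := by
                by_contra hcon
                have := hzmin u (mem_filter.2 ⟨huQ, hcon⟩)
                omega
              -- hence `dist a z ≤ dist a u + 1 ≤ r + 1`
              obtain ⟨q', hq'⟩ := q.reverse.reachable.exists_walk_length_eq_dist
              have hw : (blockTouchGraph Q).dist a z ≤ (q'.concat h.symm).length := SimpleGraph.dist_le _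
              rw [SimpleGraph.Walk.length_concat, hq'] at hw
              omega
        have hzB1 : z ∈ B (r + 1) := mem_filter.2 ⟨hzQ, key⟩
        have hzB : z ∉ B r := fun h => by
          have := (mem_filter.1 h).2; omega
        have hmono : B r ⊆ B (r + 1) := fun x hx => by
          simp only [hB, mem_filter] at hx ⊢; exact ⟨hx.1, hx.2.trans (Nat.le_succ r)⟩
        have hcard : (B r).card + 1 ≤ (B (r + 1)).card := by
          have : insert z (B r) ⊆ B (r + 1) := insert_subset hzB1 hmono
          calc (B r).card + 1 = (insert z (B r)).card := (card_insert_of_notMem hzB).symm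
            _ ≤ (B (r + 1)).card := card_le_card this
        calc min (r + 1 + 1) Q.card ≤ min (r + 1) Q.card + 1 := by omega
          _ ≤ (B r).card + 1 := by simpa [hB] using add_le_add_right ih 1
          _ ≤ (B (r + 1)).card := hcard

/-- **A touching-connected set on which the coarse map is injective has at most `2^d` elements**
(for side lengths `L_k ≥ 2^{d+1} + 1`): the ball of graph-radius `2^d` around any point has at least
`2^d + 1` elements if the set is larger, but `ℓ^∞`-radius `≤ 2^d`, so it meets at most `2^d`
coarse blocks. [cite: BrydgesSlade2015RGV, Lemma C.3 (proof, base case)] -/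
theorem card_le_two_pow_of_injOn_of_preconnected {L : Fin d → ℕ} (hL : ∀ k, 2 ^ (d + 1) + 1 ≤ L k)
    {Q : Finset (Fin d → ℤ)} (hQ : ∀ x ∈ Q, ∀ y ∈ Q, (blockTouchGraph Q).Reachable x y)
    (hinj : Set.InjOn (coarse L) Q) : Q.card ≤ 2 ^ d := by
  classical
  by_contra hbig
  push Not at hbig
  obtain ⟨a, ha⟩ : Q.Nonempty := card_pos.1 ((Nat.zero_le _).trans_lt hbig)
  set B := Q.filter fun x => (blockTouchGraph Q).dist a x ≤ 2 ^ d with hB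
  have hBcard : 2 ^ d + 1 ≤ B.card := by
    have h := min_le_card_ball hQ ha (2 ^ d)
    rw [min_eq_left (by omega)] at h
    exact h
  have hBQ : B ⊆ Q := filter_subset _ _
  have hdiam : ∀ x ∈ B, ∀ k, |x k - a k| ≤ ((2 ^ d : ℕ) : ℤ) := by
    intro x hx k
    obtain ⟨hxQ, hxd⟩ := mem_filter.1 hx
    have h := abs_sub_le_dist (hQ a ha x hxQ) k
    rw [abs_sub_comm] at h
    exact h.trans (by exact_mod_cast hxd)
  have h2r : ∀ k, 2 * 2 ^ d + 1 ≤ L k := fun k => by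
    have h := hL k
    rw [pow_succ] at h
    omega
  have himg : (B.image (coarse L)).card ≤ 2 ^ d :=
    card_image_coarse_le_two_pow_of_diam (r := 2 ^ d) h2r a B hdiam
  have hinjB : Set.InjOn (coarse L) B := hinj.mono (by exact_mod_cast hBQ)
  rw [card_image_of_injOn hinjB] at himg
  omega

/-! ### Walk lemmas for the charging argument -/

/-- Every vertex of a walk is reachable from its start. [folklore] -/
theorem reachable_of_mem_support {X : Finset (Fin d → ℤ)} {x y : Fin d → ℤ} (p : (blockTouchGraph X).Walk x y) :
    ∀ v ∈ p.support, (blockTouchGraph X).Reachable x v := by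
  induction p with
  | nil => intro v hv; simp only [SimpleGraph.Walk.support_nil, List.mem_singleton] at hv; subst hv; rfl
  | cons h q ih =>
      intro v hv
      simp only [SimpleGraph.Walk.support_cons, List.mem_cons] at hv
      rcases hv with rfl | hv
      · rfl
      · exact h.reachable.trans (ih v hv)

/-- **Transfer**: a walk of the touching graph of `S` all of whose vertices lie in `Q` gives
reachability in the touching graph of `Q`. [folklore] -/
theorem reachable_blockTouchGraph_of_support_subset {S Q : Finset (Fin d → ℤ)} {x y : Fin d → ℤ}
    (p : (blockTouchGraph S).Walk x y) (hp : ∀ v ∈ p.support, v ∈ Q) : (blockTouchGraph Q).Reachable x y := by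
  induction p with
  | nil => rfl
  | cons h q ih =>
      rename_i u v w
      have hu : u ∈ Q := hp u (by simp)
      have hv : v ∈ Q := hp v (by simp)
      have hadj : (blockTouchGraph Q).Adj u v := ⟨h.1, hu, hv, h.2.2.2⟩
      exact hadj.reachable.trans (ih fun z hz => hp z (by simp [hz]))

/-- **First exit**: a walk from inside `Q` to outside `Q` has an edge leaving `Q`. [folklore] -/
theorem exists_adj_mem_not_mem {X Q : Finset (Fin d → ℤ)} {x y : Fin d → ℤ} (p : (blockTouchGraph X).Walk x y)
    (hx : x ∈ Q) (hy : y ∉ Q) : ∃ u v, (blockTouchGraph X).Adj u v ∧ u ∈ Q ∧ v ∉ Q := by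
  induction p with
  | nil => exact absurd hx hy
  | cons h q ih =>
      rename_i u v w
      by_cases hv : v ∈ Q
      · exact ih hv hy
      · exact ⟨u, v, h, hx, hv⟩

/-- The `3^d` blocks touching a given block `u`, as a `piFinset`. [folklore] -/
def blockTouchSet (u : Fin d → ℤ) : Finset (Fin d → ℤ) :=
  Fintype.piFinset fun k => ({u k - 1, u k, u k + 1} : Finset ℤ)

/-- Membership in `blockTouchSet`. [folklore] -/
theorem mem_blockTouchSet_of_blockTouch {u t : Fin d → ℤ} (h : BlockTouch t u) : t ∈ blockTouchSet u := by
  refine Fintype.mem_piFinset.2 fun k => ?_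
  have h1 := h k
  rw [abs_le] at h1
  simp only [Finset.mem_insert, Finset.mem_singleton]
  omega

/-- `|blockTouchSet u| = 3^d`. [folklore] -/
theorem card_blockTouchSet_eq (u : Fin d → ℤ) : (blockTouchSet u).card = 3 ^ d := by
  unfold blockTouchSet
  rw [Fintype.card_piFinset]
  have h3 : ∀ k, (({u k - 1, u k, u k + 1} : Finset ℤ)).card = 3 := fun k => by
    rw [card_insert_of_notMem (by simp; omega), card_insert_of_notMem (by simp), card_singleton]
  simp only [h3, prod_const, card_univ, Fintype.card_fin]

/-- `u ∈ blockTouchSet u`. [folklore] -/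
theorem self_mem_blockTouchSet (u : Fin d → ℤ) : u ∈ blockTouchSet u := mem_blockTouchSet_of_blockTouch (BlockTouch.refl u)

/-! ### The main theorem -/

/-- **Large connected sets contract under coarse-graining** (the `η`-inequality). Let the side
lengths satisfy `L_k ≥ 2^{d+1} + 1`, let `X ⊆ ℤ^d` be a finite set of fine blocks which is connected
for the touching relation and not small, `|X| ≥ 2^d + 1`. Then with `K = 2^d (3^d − 1)`,
`(K + 2)·|π(X)| ≤ (K + 1)·|X|`, i.e. `|X| ≥ (1 + 1/(K+1))·|X̄|`.
[cite: BrydgesSlade2015RGV, Lemma C.3 / (e:etaineq)] -/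
theorem card_coarse_image_le_of_connected {L : Fin d → ℕ} (hL : ∀ k, 2 ^ (d + 1) + 1 ≤ L k)
    {X : Finset (Fin d → ℤ)} (hconn : IsBlockConnected X) (hlarge : 2 ^ d + 1 ≤ X.card) :
    (2 ^ d * (3 ^ d - 1) + 2) * (X.image (coarse L)).card ≤ (2 ^ d * (3 ^ d - 1) + 1) * X.card := by
  classical
  have hL1 : ∀ k, 1 ≤ L k := fun k => le_trans (Nat.succ_le_succ (Nat.zero_le _)) (hL k)
  set π : (Fin d → ℤ) → (Fin d → ℤ) := coarse L with hπ
  set U : Finset (Fin d → ℤ) := X.image π with hU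
  set fib : (Fin d → ℤ) → Finset (Fin d → ℤ) := fun u => X.filter fun x => π x = u with hfib
  set S : Finset (Fin d → ℤ) := X.filter fun x => (fib (π x)).card = 1 with hS
  set U₁ : Finset (Fin d → ℤ) := U.filter fun u => (fib u).card = 1 with hU₁
  set U₂ : Finset (Fin d → ℤ) := U.filter fun u => ¬ (fib u).card = 1 with hU₂
  have hSX : S ⊆ X := filter_subset _ _
  -- (F1) fibres over `U` are non-empty; over `U₂` they have at least two elements
  have hfib1 : ∀ u ∈ U, 1 ≤ (fib u).card := by
    intro u hu
    obtain ⟨x, hx, rfl⟩ := mem_image.1 hu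
    exact card_pos.2 ⟨x, mem_filter.2 ⟨hx, rfl⟩⟩
  have hfib2 : ∀ u ∈ U₂, 2 ≤ (fib u).card := by
    intro u hu
    obtain ⟨huU, hne⟩ := mem_filter.1 hu
    have := hfib1 u huU
    omega
  -- (F2) `|U| = |U₁| + |U₂|`
  have hUcard : U.card = U₁.card + U₂.card := (card_filter_add_card_filter_not _).symm
  -- (F3) `|X| = Σ_u |fib u| ≥ |U₁| + 2 |U₂|`
  have hXsum : X.card = ∑ u ∈ U, (fib u).card :=
    card_eq_sum_card_fiberwise fun x hx => mem_image_of_mem π hx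
  have hXge : U₁.card + 2 * U₂.card ≤ X.card := by
    rw [hXsum, ← sum_filter_add_sum_filter_not U (fun u => (fib u).card = 1)]
    have h1 : U₁.card ≤ ∑ u ∈ U₁, (fib u).card := by
      rw [card_eq_sum_ones]
      exact sum_le_sum fun u hu => hfib1 u (mem_filter.1 hu).1
    have h2 : 2 * U₂.card ≤ ∑ u ∈ U₂, (fib u).card := by
      rw [card_eq_sum_ones, mul_sum]
      exact sum_le_sum fun u hu => by simpa using hfib2 u hu
    exact add_le_add h1 h2
  -- (F4) `π` is injective on `S`
  have hinjS : Set.InjOn π S := by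
    intro x hx y hy hxy
    have hx' := mem_filter.1 (show x ∈ S from hx)
    have hy' := mem_filter.1 (show y ∈ S from hy)
    obtain ⟨a, ha⟩ := card_eq_one.1 hx'.2
    have hxa : x ∈ fib (π x) := mem_filter.2 ⟨hx'.1, rfl⟩
    have hya : y ∈ fib (π x) := mem_filter.2 ⟨hy'.1, hxy.symm⟩
    rw [ha, mem_singleton] at hxa hya
    rw [hxa, hya]
  -- (F5) `|S| = |U₁|`
  have hSimg : S.image π = U₁ := by
    ext u
    constructor
    · intro hu
      obtain ⟨x, hx, rfl⟩ := mem_image.1 hu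
      obtain ⟨hxX, hx1⟩ := mem_filter.1 hx
      exact mem_filter.2 ⟨mem_image_of_mem π hxX, hx1⟩
    · intro hu
      obtain ⟨huU, hu1⟩ := mem_filter.1 hu
      obtain ⟨x, hx, rfl⟩ := mem_image.1 huU
      exact mem_image.2 ⟨x, mem_filter.2 ⟨hx, hu1⟩, rfl⟩
  have hScard : S.card = U₁.card := by rw [← hSimg, card_image_of_injOn hinjS]
  -- (F6) components of the touching graph of `S`
  set comp : (Fin d → ℤ) → Finset (Fin d → ℤ) := fun x => S.filter fun y => (blockTouchGraph S).Reachable x y with hcomp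
  have hcomp_sub : ∀ x, comp x ⊆ S := fun x => filter_subset _ _
  have hmem_comp_self : ∀ x ∈ S, x ∈ comp x := fun x hx => mem_filter.2 ⟨hx, Reachable.refl _⟩
  have hcomp_eq : ∀ x, ∀ y ∈ comp x, comp y = comp x := by
    intro x y hy
    have hxy : (blockTouchGraph S).Reachable x y := (mem_filter.1 hy).2
    ext z
    simp only [hcomp, mem_filter]
    constructor
    · rintro ⟨hz, hyz⟩; exact ⟨hz, hxy.trans hyz⟩
    · rintro ⟨hz, hxz⟩; exact ⟨hz, hxy.symm.trans hxz⟩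
  -- each component is touch-connected within itself, with `π` injective, hence has `≤ 2^d` elements
  have hcomp_conn : ∀ x ∈ S, ∀ y ∈ comp x, ∀ z ∈ comp x, (blockTouchGraph (comp x)).Reachable y z := by
    intro x hx y hy z hz
    have hxy : (blockTouchGraph S).Reachable x y := (mem_filter.1 hy).2
    have hxz : (blockTouchGraph S).Reachable x z := (mem_filter.1 hz).2
    obtain ⟨p⟩ := hxy.symm.trans hxz
    refine reachable_blockTouchGraph_of_support_subset p fun v hv => ?_
    have hyv : (blockTouchGraph S).Reachable y v := reachable_of_mem_support p v hv
    by_cases hvy : v = y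
    · rw [hvy]; exact hy
    · have hvS : v ∈ S := mem_of_reachable hyv (Ne.symm hvy)
      exact mem_filter.2 ⟨hvS, hxy.trans hyv⟩
  have hcomp_card : ∀ x ∈ S, (comp x).card ≤ 2 ^ d := fun x hx =>
    card_le_two_pow_of_injOn_of_preconnected hL (hcomp_conn x hx) (hinjS.mono (by exact_mod_cast hcomp_sub x))
  -- (F7) `X ≠ S`: otherwise `X` itself would be a `π`-injective connected set with `> 2^d` elements
  have hXS : ∃ w ∈ X, w ∉ S := by
    by_contra hall
    push Not at hall
    have hSX' : S = X := Subset.antisymm hSX fun x hx => hall x hx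
    have hinjX : Set.InjOn π X := by rw [← hSX']; exact hinjS
    have hc := card_le_two_pow_of_injOn_of_preconnected hL hconn.2 hinjX
    exact Nat.not_succ_le_self _ (hlarge.trans hc)
  -- every component touches a fine block of `X` outside `S`
  have hwit : ∀ Q ∈ S.image comp, ∃ u ∈ Q, ∃ v ∈ X, v ∉ S ∧ BlockTouch u v := by
    intro Q hQ
    obtain ⟨x₀, hx₀, rfl⟩ := mem_image.1 hQ
    obtain ⟨w, hwX, hwS⟩ := hXS
    have hw : w ∉ comp x₀ := fun h => hwS (hcomp_sub x₀ h)
    obtain ⟨p⟩ := hconn.2 x₀ (hSX hx₀) w hwX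
    obtain ⟨u, v, hadj, hu, hv⟩ := exists_adj_mem_not_mem p (hmem_comp_self x₀ hx₀) hw
    refine ⟨u, hu, v, hadj.2.2.1, fun hvS => hv ?_, hadj.2.2.2⟩
    -- if `v ∈ S` then `v` is adjacent to `u` in the touching graph of `S`, so `v ∈ comp x₀`
    have hadjS : (blockTouchGraph S).Adj u v := ⟨hadj.1, hcomp_sub x₀ hu, hvS, hadj.2.2.2⟩
    exact mem_filter.2 ⟨hvS, ((mem_filter.1 hu).2).trans hadjS.reachable⟩
  choose! fu hfu fv hfv using hwit
  set C : Finset (Finset (Fin d → ℤ)) := S.image comp with hC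
  -- (F6b) `|S| = Σ_{Q ∈ C} |Q| ≤ 2^d |C|`
  have hSsum : S.card = ∑ Q ∈ C, Q.card := by
    rw [card_eq_sum_card_fiberwise (f := comp) (t := C) fun x hx => mem_image_of_mem comp hx]
    refine sum_congr rfl fun Q hQ => ?_
    obtain ⟨x₀, hx₀, rfl⟩ := mem_image.1 hQ
    congr 1
    ext y
    simp only [mem_filter]
    constructor
    · rintro ⟨hyS, hyc⟩; rw [← hyc]; exact hmem_comp_self y hyS
    · intro hy; exact ⟨hcomp_sub x₀ hy, hcomp_eq x₀ y hy⟩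
  have hSle : S.card ≤ 2 ^ d * C.card := by
    rw [hSsum]
    calc ∑ Q ∈ C, Q.card ≤ ∑ Q ∈ C, 2 ^ d := sum_le_sum fun Q hQ => by
            obtain ⟨x₀, hx₀, rfl⟩ := mem_image.1 hQ
            exact hcomp_card x₀ hx₀
      _ = 2 ^ d * C.card := by rw [sum_const, smul_eq_mul, mul_comm]
  -- (F8)–(F9) charging: `|C| ≤ (3^d − 1) |U₂|`
  have hcharge : ∀ Q ∈ C, π (fv Q) ∈ U₂ := by
    intro Q hQ
    obtain ⟨hvX, hvS, -⟩ := hfv Q hQ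
    refine mem_filter.2 ⟨mem_image_of_mem π hvX, fun h1 => hvS ?_⟩
    exact mem_filter.2 ⟨hvX, h1⟩
  have htag_ne : ∀ Q ∈ C, π (fu Q) ≠ π (fv Q) := by
    intro Q hQ h
    obtain ⟨hvX, hvS, -⟩ := hfv Q hQ
    have huS : fu Q ∈ S := by
      obtain ⟨x₀, hx₀, rfl⟩ := mem_image.1 hQ
      exact hcomp_sub x₀ (hfu _ hQ)
    have h1 : (fib (π (fu Q))).card = 1 := (mem_filter.1 huS).2
    rw [h] at h1
    exact hvS (mem_filter.2 ⟨hvX, h1⟩)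
  have htag_touch : ∀ Q ∈ C, BlockTouch (π (fu Q)) (π (fv Q)) := fun Q hQ =>
    coarse_sub_coarse_le_one hL1 (hfv Q hQ).2.2
  have htag_inj : Set.InjOn (fun Q => π (fu Q)) C := by
    intro Q hQ Q' hQ' h
    have huS : fu Q ∈ S := by
      obtain ⟨x₀, hx₀, rfl⟩ := mem_image.1 hQ; exact hcomp_sub x₀ (hfu _ hQ)
    have huS' : fu Q' ∈ S := by
      obtain ⟨x₀, hx₀, rfl⟩ := mem_image.1 hQ'; exact hcomp_sub x₀ (hfu _ hQ')
    have heq : fu Q = fu Q' := hinjS huS huS' h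
    have hQ1 : Q = comp (fu Q) := by
      obtain ⟨x₀, hx₀, rfl⟩ := mem_image.1 hQ; exact (hcomp_eq x₀ _ (hfu _ hQ)).symm
    have hQ2 : Q' = comp (fu Q') := by
      obtain ⟨x₀, hx₀, rfl⟩ := mem_image.1 hQ'; exact (hcomp_eq x₀ _ (hfu _ hQ')).symm
    rw [hQ1, hQ2, heq]
  have hCle : C.card ≤ (3 ^ d - 1) * U₂.card := by
    rw [card_eq_sum_card_fiberwise (f := fun Q => π (fv Q)) (t := U₂) hcharge]
    calc ∑ u' ∈ U₂, (C.filter fun Q => π (fv Q) = u').card ≤ ∑ u' ∈ U₂, (3 ^ d - 1) := by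
          refine sum_le_sum fun u' hu' => ?_
          have hT : ((blockTouchSet u').erase u').card = 3 ^ d - 1 := by
            rw [card_erase_of_mem (self_mem_blockTouchSet u'), card_blockTouchSet_eq]
          rw [← hT]
          refine card_le_card_of_injOn (fun Q => π (fu Q)) (fun Q hQ => ?_) (htag_inj.mono fun Q hQ => (mem_filter.1 hQ).1)
          obtain ⟨hQC, hQu⟩ := mem_filter.1 hQ
          refine mem_erase.2 ⟨?_, mem_blockTouchSet_of_blockTouch ?_⟩
          · rw [← hQu]; exact htag_ne Q hQC
          · rw [← hQu]; exact htag_touch Q hQC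
      _ = (3 ^ d - 1) * U₂.card := by rw [sum_const, smul_eq_mul, mul_comm]
  -- (F10) arithmetic
  have hU1le : U₁.card ≤ 2 ^ d * (3 ^ d - 1) * U₂.card := by
    calc U₁.card = S.card := hScard.symm
      _ ≤ 2 ^ d * C.card := hSle
      _ ≤ 2 ^ d * ((3 ^ d - 1) * U₂.card) := Nat.mul_le_mul_left _ hCle
      _ = 2 ^ d * (3 ^ d - 1) * U₂.card := by ring
  set K : ℕ := 2 ^ d * (3 ^ d - 1) with hK
  rw [hUcard]
  calc (K + 2) * (U₁.card + U₂.card) = (K + 1) * U₁.card + U₁.card + (K + 2) * U₂.card := by ring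
    _ ≤ (K + 1) * U₁.card + K * U₂.card + (K + 2) * U₂.card := by
        have := hU1le; omega
    _ = (K + 1) * (U₁.card + 2 * U₂.card) := by ring
    _ ≤ (K + 1) * X.card := Nat.mul_le_mul_left _ hXge

/-- **The `η`-form**: under the same hypotheses, `|X̄| ≤ |X|` improves to
`|π(X)| · (1 + 1/(K+1)) ≤ |X|` in `ℚ`, `K = 2^d(3^d−1)`. [cite: BrydgesSlade2015RGV, Lemma C.3 / (e:etaineq)] -/
theorem eta_mul_card_coarse_image_le {L : Fin d → ℕ} (hL : ∀ k, 2 ^ (d + 1) + 1 ≤ L k)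
    {X : Finset (Fin d → ℤ)} (hconn : IsBlockConnected X) (hlarge : 2 ^ d + 1 ≤ X.card) :
    (1 + 1 / ((2 : ℚ) ^ d * (3 ^ d - 1) + 1)) * (X.image (coarse L)).card ≤ X.card := by
  have h := card_coarse_image_le_of_connected hL hconn hlarge
  have hK : (1 : ℚ) ≤ 3 ^ d := one_le_pow₀ (by norm_num)
  have hpos : (0 : ℚ) < (2 : ℚ) ^ d * (3 ^ d - 1) + 1 := by positivity
  have h' : (((2 ^ d * (3 ^ d - 1) + 2) * (X.image (coarse L)).card : ℕ) : ℚ) ≤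
      (((2 ^ d * (3 ^ d - 1) + 1) * X.card : ℕ) : ℚ) := by exact_mod_cast h
  have h3 : ((3 ^ d - 1 : ℕ) : ℚ) = (3 : ℚ) ^ d - 1 := by
    rw [Nat.cast_sub (Nat.one_le_pow _ _ (by norm_num))]; push_cast; ring
  push_cast at h'
  rw [h3] at h'
  rw [one_add_div hpos.ne', div_mul_eq_mul_div, div_le_iff₀ hpos]
  ring_nf
  ring_nf at h'
  linarith

end Literature.Probability.LatticeModels
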